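import Literature.AlgebraicTopology.SingularHomology.CupRightMayerVietoris
import HarnessLib

/-!
# Degree-shifting maps of cochain complexes: induced maps on cohomology and connecting maps

A. Hatcher, *Algebraic Topology* (2002), §3.2 p. 209 / Lemma 3.6 and §3.1 p. 204: a product with a
fixed cocycle of degree `q` (cup product with a global class, wedge product with a closed form) is
a family of maps `Kⁱ → K'^{i+q}` commuting with the differentials; it induces maps
`Hⁱ(K) → H^{i+q}(K')`, and when it is compatible with two short exact sequences of complexes it
commutes with their connecting homomorphisms ("`δ(α ⌣ β) = δα ⌣ β`", Husemoller, *Fibre Bundles*,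
Ch. 17 §1, proof of Thm. 1.1).

For cochain complexes of `R`-modules of the tree's shape `(ComplexShape.down ℕ).symm` we define
`DegShiftMap K K' q` — a family `app i n (h : i + q = n) : Kⁱ →ₗ[R] K'ⁿ` with
`d (app x) = app (d x)` (the degree bookkeeping `i + q = n` is carried as an equation, so that no
transport along `(i + 1) + q = (i + q) + 1` is ever needed) — and prove:

* `DegShiftMap.mapH`: the induced maps `Hⁱ(K) →ₗ[R] Hⁿ(K')`, `[z] ↦ [app z]` (`mapH_homologyCls`);
* `DegShiftMap.mapH_comm`: naturality with respect to genuine morphisms of complexes on both sides;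
* `DegShiftMap.δ_mapH`: **compatibility with connecting homomorphisms** — for short exact
  `S`, `S'` and degree-`q` maps `φ₁, φ₂, φ₃` between their terms commuting with `f`, `g`,
  `δ' (φ₃ y) = φ₁ (δ y)` (proof: Mathlib's `ShortExact.δ_apply` on a lift of a representative and
  on its image).

Everything is proved; no named facts.

## References

* [HatcherAT2002] A. Hatcher, *Algebraic Topology*, CUP 2002, §3.1 p. 204, §3.2 p. 209, Lemma 3.6.
* [HusemollerFibreBundles1994] D. Husemoller, *Fibre Bundles*, 3rd ed. (1994), Ch. 17 §1 Thm. 1.1 (proof).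
-/

noncomputable section

open CategoryTheory Limits

universe u v

namespace Literature.AlgebraicTopology.SingularHomology

variable {R : Type v} [CommRing R]

/-- **A degree-`q` map of cochain complexes** `K → K'`: linear maps `Kⁱ → K'ⁿ` for `i + q = n`
commuting with the differentials (Hatcher 2002, Lemma 3.6: `⌣ β` for a cocycle `β`).
[cite: HatcherAT2002, Lemma 3.6] -/
structure DegShiftMap (K K' : HomologicalComplex (ModuleCat.{max u v} R) (ComplexShape.down ℕ).symm) (q : ℕ) where
  /-- the component `Kⁱ → K'ⁿ`, `i + q = n` -/
  app : ∀ (i n : ℕ), i + q = n → (K.X i →ₗ[R] K'.X n)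
  /-- the components commute with the differentials -/
  comm_d : ∀ (i n : ℕ) (h : i + q = n) (x : K.X i),
    K'.d n (n + 1) (app i n h x) = app (i + 1) (n + 1) (by omega) (K.d i (i + 1) x)

namespace DegShiftMap

variable {K K' : HomologicalComplex (ModuleCat.{max u v} R) (ComplexShape.down ℕ).symm} {q : ℕ} (φ : DegShiftMap K K' q)

/-- A degree-`q` map sends cocycles to cocycles. [cite: HatcherAT2002, Lemma 3.6] -/
theorem d_app_eq_zero {i n : ℕ} (h : i + q = n) {x : K.X i} (hx : K.d i (i + 1) x = 0) :
    K'.d n (n + 1) (φ.app i n h x) = 0 := by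
  rw [φ.comm_d i n h x, hx, map_zero]

/-- The same in the `next`-form of the cocycle condition. [folklore] -/
theorem d_next_app_eq_zero {i n : ℕ} (h : i + q = n) {x : K.X i}
    (hx : K.d i ((ComplexShape.down ℕ).symm.next i) x = 0) :
    K'.d n ((ComplexShape.down ℕ).symm.next n) (φ.app i n h x) = 0 :=
  (d_next_eq_zero_iff (SimplexSpan.symm_down_next n) _).2
    (φ.d_app_eq_zero h ((d_next_eq_zero_iff (SimplexSpan.symm_down_next i) _).1 hx))

/-- `[x] ↦ [φ x]` on cocycles (kernel form). [folklore] -/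
def mapKer {i n : ℕ} (h : i + q = n) : LinearMap.ker ((K.sc i).g.hom) →ₗ[R] K'.homology n where
  toFun x := homologyCls (φ.app i n h x.1) (φ.d_next_app_eq_zero h (LinearMap.mem_ker.1 x.2))
  map_add' x x' := by
    refine (homologyCls_congr (map_add _ _ _) _ ?_).trans (homologyCls_add _ _ _ _ _)
    rw [map_add, φ.d_next_app_eq_zero h (LinearMap.mem_ker.1 x.2),
      φ.d_next_app_eq_zero h (LinearMap.mem_ker.1 x'.2), add_zero]
  map_smul' r x := by
    refine (homologyCls_congr (map_smul _ _ _) _ ?_).trans (homologyCls_smul _ _ _ _)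
    rw [map_smul, φ.d_next_app_eq_zero h (LinearMap.mem_ker.1 x.2), smul_zero]

/-- `mapKer` on a cocycle is the class of its image. [folklore] -/
theorem mapKer_apply {i n : ℕ} (h : i + q = n) (x : LinearMap.ker ((K.sc i).g.hom)) :
    φ.mapKer h x = homologyCls (φ.app i n h x.1) (φ.d_next_app_eq_zero h (LinearMap.mem_ker.1 x.2)) :=
  rfl

/-- `mapKer` kills coboundaries: `[φ (d w)] = [d (φ w)] = 0`. [cite: HatcherAT2002, Lemma 3.6] -/
theorem mapKer_d {i n : ℕ} (h : i + q = n) (j : ℕ) (w : K.X j) :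
    φ.mapKer h ⟨K.d j i w, d_mem_ker j w⟩ = 0 := by
  by_cases hj : (ComplexShape.down ℕ).symm.Rel j i
  · obtain rfl : j + 1 = i := hj
    obtain rfl : n = (j + q) + 1 := by omega
    rw [mapKer_apply]
    have e : φ.app (j + 1) (j + q + 1) h (K.d j (j + 1) w) = K'.d (j + q) (j + q + 1) (φ.app j (j + q) rfl w) :=
      (φ.comm_d j (j + q) rfl w).symm
    have hd2 : K'.d (j + q + 1) ((ComplexShape.down ℕ).symm.next (j + q + 1))
        (K'.d (j + q) (j + q + 1) (φ.app j (j + q) rfl w)) = 0 := by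
      rw [← ModuleCat.comp_apply, HomologicalComplex.d_comp_d]
      rfl
    exact (homologyCls_congr e _ hd2).trans (homologyCls_d_eq_zero_symm (j + q) _ hd2)
  · have e : (⟨K.d j i w, d_mem_ker j w⟩ : LinearMap.ker ((K.sc i).g.hom)) = 0 := by
      apply Subtype.ext
      change K.d j i w = 0
      rw [K.shape j i hj]
      rfl
    rw [e, map_zero]

/-- **The map `Hⁱ(K) → Hⁿ(K')` induced by a degree-`q` map** (`i + q = n`).
[cite: HatcherAT2002, §3.2 p. 209] -/
def mapH (i n : ℕ) (h : i + q = n) : K.homology i →ₗ[R] K'.homology n :=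
  homologyDescKer (φ.mapKer h) fun w ↦ φ.mapKer_d h _ w

/-- `mapH [x] = [φ x]`. [cite: HatcherAT2002, §3.2 p. 209] -/
theorem mapH_homologyCls {i n : ℕ} (h : i + q = n) (x : K.X i)
    (hx : K.d i ((ComplexShape.down ℕ).symm.next i) x = 0) :
    φ.mapH i n h (homologyCls x hx) = homologyCls (φ.app i n h x) (φ.d_next_app_eq_zero h hx) := by
  rw [mapH, homologyDescKer_homologyCls]
  rfl

/-- **Naturality of `mapH` under morphisms of complexes**: if degree-`q` maps `φ : K → K'`,
`ψ : L → L'` intertwine morphisms `u : K ⟶ L`, `u' : K' ⟶ L'` degreewise, they do so on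
cohomology. [folklore] -/
theorem mapH_comm {L L' : HomologicalComplex (ModuleCat.{max u v} R) (ComplexShape.down ℕ).symm} (ψ : DegShiftMap L L' q)
    (u : K ⟶ L) (u' : K' ⟶ L')
    (hcomm : ∀ (i n : ℕ) (h : i + q = n) (x : K.X i), ψ.app i n h (u.f i x) = u'.f n (φ.app i n h x))
    {i n : ℕ} (h : i + q = n) (y : K.homology i) :
    ψ.mapH i n h (HomologicalComplex.homologyMap u i y) =
      HomologicalComplex.homologyMap u' n (φ.mapH i n h y) := by
  obtain ⟨x, hx, rfl⟩ := homologyCls_surjective y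
  rw [homologyMap_homologyCls, ψ.mapH_homologyCls, φ.mapH_homologyCls, homologyMap_homologyCls]
  exact homologyCls_congr (hcomm i n h x) _ _

/-- Post-composition of a degree-`q` map with a morphism of complexes. [folklore] -/
def compHom {K'' : HomologicalComplex (ModuleCat.{max u v} R) (ComplexShape.down ℕ).symm} (u : K' ⟶ K'') : DegShiftMap K K'' q where
  app i n h := (u.f n).hom ∘ₗ φ.app i n h
  comm_d i n h x := by
    change K''.d n (n + 1) (u.f n (φ.app i n h x)) = u.f (n + 1) (φ.app (i + 1) (n + 1) _ (K.d i (i + 1) x))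
    rw [← ModuleCat.comp_apply, u.comm, ModuleCat.comp_apply, φ.comm_d]

/-- Pre-composition of a degree-`q` map with a morphism of complexes. [folklore] -/
def precompHom {K₀ : HomologicalComplex (ModuleCat.{max u v} R) (ComplexShape.down ℕ).symm} (u : K₀ ⟶ K) : DegShiftMap K₀ K' q where
  app i n h := φ.app i n h ∘ₗ (u.f i).hom
  comm_d i n h x := by
    change K'.d n (n + 1) (φ.app i n h (u.f i x)) = φ.app (i + 1) (n + 1) _ (u.f (i + 1) (K₀.d i (i + 1) x))
    rw [φ.comm_d, ← ModuleCat.comp_apply, u.comm, ModuleCat.comp_apply]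

/-- `mapH` of a post-composition. [folklore] -/
theorem mapH_compHom {K'' : HomologicalComplex (ModuleCat.{max u v} R) (ComplexShape.down ℕ).symm} (u : K' ⟶ K'') {i n : ℕ}
    (h : i + q = n) (y : K.homology i) :
    (φ.compHom u).mapH i n h y = HomologicalComplex.homologyMap u n (φ.mapH i n h y) := by
  obtain ⟨x, hx, rfl⟩ := homologyCls_surjective y
  rw [mapH_homologyCls, mapH_homologyCls, homologyMap_homologyCls]
  rfl

/-- `mapH` of a pre-composition. [folklore] -/
theorem mapH_precompHom {K₀ : HomologicalComplex (ModuleCat.{max u v} R) (ComplexShape.down ℕ).symm} (u : K₀ ⟶ K) {i n : ℕ}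
    (h : i + q = n) (y : K₀.homology i) :
    (φ.precompHom u).mapH i n h y = φ.mapH i n h (HomologicalComplex.homologyMap u i y) := by
  obtain ⟨x, hx, rfl⟩ := homologyCls_surjective y
  rw [mapH_homologyCls, homologyMap_homologyCls, mapH_homologyCls]
  rfl

end DegShiftMap

/-! ### Compatibility with connecting homomorphisms -/

section Delta

variable {S S' : ShortComplex (HomologicalComplex (ModuleCat.{max u v} R) (ComplexShape.down ℕ).symm)} (hS : S.ShortExact)
  (hS' : S'.ShortExact) {q : ℕ}
  (φ₁ : DegShiftMap S.X₁ S'.X₁ q) (φ₂ : DegShiftMap S.X₂ S'.X₂ q) (φ₃ : DegShiftMap S.X₃ S'.X₃ q)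

/-- Degreewise surjectivity of `g` in a short exact sequence of complexes of modules. [folklore] -/
theorem shortExact_g_f_surjective {S : ShortComplex (HomologicalComplex (ModuleCat.{max u v} R) (ComplexShape.down ℕ).symm)}
    (hS : S.ShortExact) (i : ℕ) : Function.Surjective (S.g.f i) :=
  (hS.map_of_exact (HomologicalComplex.eval (ModuleCat.{max u v} R) (ComplexShape.down ℕ).symm i)).moduleCat_surjective_g

/-- Degreewise injectivity of `f` in a short exact sequence of complexes of modules. [folklore] -/
theorem shortExact_f_f_injective {S : ShortComplex (HomologicalComplex (ModuleCat.{max u v} R) (ComplexShape.down ℕ).symm)}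
    (hS : S.ShortExact) (i : ℕ) : Function.Injective (S.f.f i) :=
  (hS.map_of_exact (HomologicalComplex.eval (ModuleCat.{max u v} R) (ComplexShape.down ℕ).symm i)).moduleCat_injective_f

/-- Degreewise exactness of a short exact sequence of complexes of modules. [folklore] -/
theorem shortExact_f_g_exact {S : ShortComplex (HomologicalComplex (ModuleCat.{max u v} R) (ComplexShape.down ℕ).symm)}
    (hS : S.ShortExact) (i : ℕ) : Function.Exact (S.f.f i) (S.g.f i) :=
  (ShortComplex.ShortExact.moduleCat_exact_iff_function_exact _).1
    (hS.map_of_exact (HomologicalComplex.eval (ModuleCat.{max u v} R) (ComplexShape.down ℕ).symm i)).exact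

/-- **The connecting homomorphism on an explicit lift**: if `x₂` lifts the cocycle `x₃` and
`f x₁ = d x₂`, then `δ [x₃] = [x₁]` (Mathlib's `ShortExact.δ_apply`, in the tree's `homologyCls`
language). [cite: HatcherAT2002, §2.1 p. 116] -/
theorem shortExact_δ_homologyCls {S : ShortComplex (HomologicalComplex (ModuleCat.{max u v} R) (ComplexShape.down ℕ).symm)}
    (hS : S.ShortExact) (i : ℕ) (x₃ : S.X₃.X i) (hx₃ : S.X₃.d i (i + 1) x₃ = 0)
    (x₂ : S.X₂.X i) (hx₂ : S.g.f i x₂ = x₃) (x₁ : S.X₁.X (i + 1))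
    (hx₁ : S.f.f (i + 1) x₁ = S.X₂.d i (i + 1) x₂)
    (hx₃' : S.X₃.d i ((ComplexShape.down ℕ).symm.next i) x₃ = 0)
    (hx₁' : S.X₁.d (i + 1) ((ComplexShape.down ℕ).symm.next (i + 1)) x₁ = 0) :
    hS.δ i (i + 1) (crel i) (homologyCls x₃ hx₃') = homologyCls x₁ hx₁' := by
  have key := hS.δ_apply i (i + 1) (crel i) x₃ hx₃ x₂ hx₂ x₁ hx₁ ((ComplexShape.down ℕ).symm.next (i + 1)) rfl
  rw [homologyCls_eq_homologyπ_cyclesMk _ _ (i + 1) (SimplexSpan.symm_down_next i),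
    homologyCls_eq_homologyπ_cyclesMk _ _ ((ComplexShape.down ℕ).symm.next (i + 1)) rfl]
  exact key

include hS hS' in
/-- **Degree-`q` maps compatible with two short exact sequences commute with their connecting
homomorphisms**: `δ' (φ₃ y) = φ₁ (δ y)` (Husemoller, Ch. 17 §1, proof of Thm. 1.1: "`θ` commutes
with the coboundary operators of the Mayer–Vietoris sequences"; Hatcher 2002, §3.2 p. 209).
[cite: HusemollerFibreBundles1994, Ch. 17 §1 Thm. 1.1 (proof)] -/
theorem DegShiftMap.δ_mapH
    (hf : ∀ (i n : ℕ) (h : i + q = n) (x : S.X₁.X i), φ₂.app i n h (S.f.f i x) = S'.f.f n (φ₁.app i n h x))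
    (hg : ∀ (i n : ℕ) (h : i + q = n) (x : S.X₂.X i), φ₃.app i n h (S.g.f i x) = S'.g.f n (φ₂.app i n h x))
    {i n : ℕ} (h : i + q = n) (y : S.X₃.homology i) :
    hS'.δ n (n + 1) (crel n) (φ₃.mapH i n h y) =
      φ₁.mapH (i + 1) (n + 1) (by omega) (hS.δ i (i + 1) (crel i) y) := by
  obtain ⟨x₃, hx₃', rfl⟩ := homologyCls_surjective y
  have hx₃ : S.X₃.d i (i + 1) x₃ = 0 := (d_next_eq_zero_iff (SimplexSpan.symm_down_next i) _).1 hx₃'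
  -- a lift `x₂` of `x₃` and the element `x₁` with `f x₁ = d x₂`
  obtain ⟨x₂, hx₂⟩ := shortExact_g_f_surjective hS i x₃
  have hdx₂ : S.g.f (i + 1) (S.X₂.d i (i + 1) x₂) = 0 := by
    rw [← ModuleCat.comp_apply, ← S.g.comm, ModuleCat.comp_apply, hx₂, hx₃]
  obtain ⟨x₁, hx₁⟩ := (shortExact_f_g_exact hS (i + 1) _).1 hdx₂
  have hx₁' : S.X₁.d (i + 1) ((ComplexShape.down ℕ).symm.next (i + 1)) x₁ = 0 := by
    rw [d_next_eq_zero_iff (SimplexSpan.symm_down_next (i + 1))]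
    -- `f (d x₁) = d (f x₁) = d (d x₂) = 0` and `f` is injective
    apply shortExact_f_f_injective hS (i + 1 + 1)
    rw [map_zero, ← ModuleCat.comp_apply, ← S.f.comm, ModuleCat.comp_apply, hx₁, ← ModuleCat.comp_apply,
      HomologicalComplex.d_comp_d]
    rfl
  rw [shortExact_δ_homologyCls hS i x₃ hx₃ x₂ hx₂ x₁ hx₁ hx₃' hx₁', φ₃.mapH_homologyCls, φ₁.mapH_homologyCls]
  -- the image data `(φ₃ x₃, φ₂ x₂, φ₁ x₁)` is again lift data
  refine shortExact_δ_homologyCls hS' n (φ₃.app i n h x₃) (φ₃.d_app_eq_zero h hx₃) (φ₂.app i n h x₂) ?_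
    (φ₁.app (i + 1) (n + 1) (by omega) x₁) ?_ _ _
  · rw [← hg, hx₂]
  · rw [← hf, hx₁, φ₂.comm_d]

end Delta

end Literature.AlgebraicTopology.SingularHomology
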